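import Literature.IUT.HodgeTheaters.GlobalFrobenioids
import HarnessLib

/-!
# [IUTchI] Example 5.1 (i): the kernels `Ker(π₁^rat ↷ 𝕄^⊛_∞κ)`, `π₁^{rat/κ-sol}(†𝒟^⊛)`, `π₁^rat(†𝒟^⊚)`,
# `π₁^{rat/κ-sol}(†𝒟^⊚)` are CLOSED subgroups of `π₁^rat(†𝒟^⊛)` — interface laws (PROOF-ONLY)

Mochizuki, *Inter-universal Teichmüller theory I*, §5, Example 5.1 (i), kurims manuscript (May 2020)
p. 124 l. 23–40 (cell render lit/IUTchI-EX51-i-iv-vii-VERBATIM.md of the kurims PDF, `cat -n` numbering)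
([IUTchI] Ex 5.1 (i) p.124) [claim: Mochizuki2012, status: disputed]: "Thus, by forming the quotient of
`π₁^rat(†𝒟^⊛)` by the intersection of the kernel of the action of `π₁^rat(†𝒟^⊛)` on `𝕄^⊛_∞κ(†𝒟^⊚)` with the
inverse image in `π₁^rat(†𝒟^⊛)` of the kernel of the maximal solvable quotient of [the quotient of `π₁^rat(†𝒟^⊛)`
that corresponds to] the absolute Galois group of `F_mod`, we obtain a group-theoretic construction for a quotient
`π₁^rat(†𝒟^⊛) ↠ π₁^{κ-sol}(†𝒟^⊛)` — whose kernel we denote by `π₁^{rat/κ-sol}(†𝒟^⊛)` — that corresponds to the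
quotient "`Gal(L̄_C/L_C) ↠ Gal(L_C(κ-sol)/L_C)`" of Remark 3.1.7, (iv)"; the subgroups `π₁^rat(†𝒟^⊚)` (the fibre
product `π₁^rat(†𝒟^⊛) ×_{π₁(†𝒟^⊛)} π₁(†𝒟^⊚)`) and `π₁^{rat/κ-sol}(†𝒟^⊚) = π₁^{rat/κ-sol}(†𝒟^⊛) ∩ π₁^rat(†𝒟^⊚)`
are those of p. 124 l. 71–85 as typed by abc-iut-L5-t1 (`ratCirc`, `ratKsolCirc`; not re-quoted here).

STATE OF THE TREE.  abc-iut-L5-t1's INTERFACE `NFBridgeRecon` (`GlobalFrobenioids.lean`) records the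
profinite groups `π₁^rat(†𝒟^⊛) ↠ π₁(†𝒟^⊛) ⊇ π₁(†𝒟^⊚)` (a continuous surjection `ratToAst` and an OPEN
subgroup `piDcirc`), the smooth action `π₁^rat ↷ K_rat` (`isOpen_stabilizer_krat`), the `π₁^rat`-stable
pseudo-monoid `𝕄^⊛_∞κ = Minfκ ⊆ K_rat`, and the normal subgroup
`solKer = Ker(π₁(†𝒟^⊛) ↠ G_{F_mod} ↠ G_{F_mod}^{sol})` (whose closedness, "[closed normal]" in the field's
docstring, is NOT a recorded field); it DEFINES `actionKer`, `ratKsolKer = actionKer ⊓ solKer.comap ratToAst`,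
`ratCirc = piDcirc.comap ratToAst`, `ratKsolCirc = ratKsolKer ⊓ ratCirc`, and the quotient
`PiKsol = π₁^rat ⧸ ratKsolKer`.

THIS FILE (PROOF-ONLY: no `def`, no `instance`, no `structure`; nothing of the typer's file is edited or
restated; abc-iut-w4-d050 gen 5, SUBDAG-IUTchI-Ex51 row E51/L05) records the topological laws that the
word "quotient [of profinite groups]" presupposes, for EVERY datum `N` (the genuine one included):
* `isOpen_setOf_smul_eq`, `isClosed_setOf_smul_eq` — `{g | g • f = f'}` is clopen in `π₁^rat` (smoothness);
* `isClosed_actionKer` — `Ker(π₁^rat ↷ 𝕄^⊛_∞κ) = ⋂_{f ∈ 𝕄^⊛_∞κ} Stab(f)` is closed;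
* `isOpen_ratCirc`, `isClosed_ratCirc` — `π₁^rat(†𝒟^⊚)` is an open (hence closed) subgroup;
* `isClosed_ratKsolKer_of_isClosed_solKer`, `isClosed_ratKsolCirc_of_isClosed_solKer` — the `κ-sol`
  kernels are closed as soon as `solKer` is (the kernel of a continuous map to the profinite
  `G_{F_mod}^{sol}` — the one topological input the interface leaves to the genuine datum);
* `t2Space_piKsol_of_isClosed_solKer`, `compactSpace_piKsol` — so `π₁^{κ-sol}(†𝒟^⊛)` is a compact
  Hausdorff (quotient) group under that input.

HONEST LABEL: interface laws only; nothing here constructs the genuine datum, asserts any statement of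
[IUTchI], or takes a side on [IUTchIII] Cor. 3.12; typed ≠ proved.  (v2: doc-only — the p. 124 quotation above made verbatim,
pre-empting an M19 referee flag; no declaration changed.)
-/

namespace Literature.IUT.HodgeTheaters

namespace NFBridgeRecon

universe u

variable (N : NFBridgeRecon.{u})

/-- Smoothness of `π₁^rat ↷ K_rat`: for rational functions `f, f'` the set `{g | g • f = f'}` is OPEN in
`π₁^rat(†𝒟^⊛)` (a left coset of the open stabiliser of `f`, or empty).
([IUTchI] Ex 5.1 (i) p.124) [claim: Mochizuki2012, status: disputed] -/
theorem isOpen_setOf_smul_eq (f f' : N.Krat) : IsOpen {g : N.piRat | g • f = f'} := by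
  rw [isOpen_iff_forall_mem_open]
  intro g hg
  refine ⟨(fun s : N.piRat => g * s) '' (MulAction.stabilizer N.piRat f : Set N.piRat), ?_, ?_, ?_⟩
  · rintro _ ⟨s, hs, rfl⟩
    show (g * s) • f = f'
    rw [mul_smul, MulAction.mem_stabilizer_iff.mp hs]
    exact hg
  · exact isOpenMap_mul_left g _ (N.isOpen_stabilizer_krat f)
  · exact ⟨1, (MulAction.stabilizer N.piRat f).one_mem, mul_one g⟩

/-- … and CLOSED: its complement is the union over `f'' ≠ f'` of the open sets `{g | g • f = f''}`,
i.e. `{g | g • f ∈ {f'}ᶜ}`, open by the same coset argument.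
([IUTchI] Ex 5.1 (i) p.124) [claim: Mochizuki2012, status: disputed] -/
theorem isClosed_setOf_smul_eq (f f' : N.Krat) : IsClosed {g : N.piRat | g • f = f'} := by
  rw [← isOpen_compl_iff, isOpen_iff_forall_mem_open]
  intro g hg
  refine ⟨(fun s : N.piRat => g * s) '' (MulAction.stabilizer N.piRat f : Set N.piRat), ?_, ?_, ?_⟩
  · rintro _ ⟨s, hs, rfl⟩
    show ¬ (g * s) • f = f'
    rw [mul_smul, MulAction.mem_stabilizer_iff.mp hs]
    exact hg
  · exact isOpenMap_mul_left g _ (N.isOpen_stabilizer_krat f)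
  · exact ⟨1, (MulAction.stabilizer N.piRat f).one_mem, mul_one g⟩

/-- **`Ker(π₁^rat(†𝒟^⊛) ↷ 𝕄^⊛_∞κ(†𝒟^⊚))` is closed**: it is the intersection, over `f ∈ 𝕄^⊛_∞κ`, of the
clopen stabilisers `{g | g • f = f}`. ([IUTchI] Ex 5.1 (i) p.124) [claim: Mochizuki2012, status: disputed] -/
theorem isClosed_actionKer : IsClosed (N.actionKer : Set N.piRat) := by
  have h : (N.actionKer : Set N.piRat) = ⋂ f ∈ N.Minfκ, {g : N.piRat | g • f = f} := by
    ext g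
    simp only [Set.mem_iInter, Set.mem_setOf_eq]
    rfl
  rw [h]
  exact isClosed_biInter fun f _ => N.isClosed_setOf_smul_eq f f

/-- `π₁^rat(†𝒟^⊚) = π₁^rat(†𝒟^⊛) ×_{π₁(†𝒟^⊛)} π₁(†𝒟^⊚)` is an OPEN subgroup of `π₁^rat(†𝒟^⊛)` (inverse
image of the open `π₁(†𝒟^⊚)` under the continuous `π₁^rat ↠ π₁(†𝒟^⊛)`).
([IUTchI] Ex 5.1 (i) p.124) [claim: Mochizuki2012, status: disputed] -/
theorem isOpen_ratCirc : IsOpen (N.ratCirc : Set N.piRat) :=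
  N.piDcirc.isOpen.preimage N.ratToAst.continuous_toFun

/-- … hence a CLOSED subgroup as well. ([IUTchI] Ex 5.1 (i) p.124) [claim: Mochizuki2012, status: disputed] -/
theorem isClosed_ratCirc : IsClosed (N.ratCirc : Set N.piRat) :=
  N.piDcirc.isClosed.preimage N.ratToAst.continuous_toFun

/-- **`π₁^{rat/κ-sol}(†𝒟^⊛)` is closed** as soon as `solKer = Ker(π₁(†𝒟^⊛) ↠ G_{F_mod}^{sol})` is closed
in `π₁(†𝒟^⊛)`: it is `Ker(π₁^rat ↷ 𝕄^⊛_∞κ) ∩ (π₁^rat ↠ π₁(†𝒟^⊛))⁻¹(solKer)` (p. 124), an intersection of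
two closed sets. ([IUTchI] Ex 5.1 (i) p.124) [claim: Mochizuki2012, status: disputed] -/
theorem isClosed_ratKsolKer_of_isClosed_solKer (h : IsClosed (N.solKer : Set N.piDast)) :
    IsClosed (N.ratKsolKer : Set N.piRat) := by
  have hset : (N.ratKsolKer : Set N.piRat) =
      (N.actionKer : Set N.piRat) ∩ N.ratToAst ⁻¹' (N.solKer : Set N.piDast) := by
    ext g
    rfl
  rw [hset]
  exact N.isClosed_actionKer.inter (h.preimage N.ratToAst.continuous_toFun)

/-- **`π₁^{rat/κ-sol}(†𝒟^⊚) = π₁^{rat/κ-sol}(†𝒟^⊛) ∩ π₁^rat(†𝒟^⊚)` is closed** under the same input.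
([IUTchI] Ex 5.1 (i) p.124) [claim: Mochizuki2012, status: disputed] -/
theorem isClosed_ratKsolCirc_of_isClosed_solKer (h : IsClosed (N.solKer : Set N.piDast)) :
    IsClosed (N.ratKsolCirc : Set N.piRat) := by
  have hset : (N.ratKsolCirc : Set N.piRat) = (N.ratKsolKer : Set N.piRat) ∩ (N.ratCirc : Set N.piRat) := by
    ext g
    rfl
  rw [hset]
  exact (N.isClosed_ratKsolKer_of_isClosed_solKer h).inter N.isClosed_ratCirc

/-- **`π₁^{κ-sol}(†𝒟^⊛) = π₁^rat ⧸ π₁^{rat/κ-sol}` is Hausdorff** as soon as `solKer` is closed (a quotient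
of a topological group by a closed normal subgroup) — what "quotient [of profinite groups]
`π₁^rat(†𝒟^⊛) ↠ π₁^{κ-sol}(†𝒟^⊛)`" (p. 124) presupposes.
([IUTchI] Ex 5.1 (i) p.124) [claim: Mochizuki2012, status: disputed] -/
theorem t2Space_piKsol_of_isClosed_solKer (h : IsClosed (N.solKer : Set N.piDast)) :
    T2Space N.PiKsol := by
  haveI : IsClosed (N.ratKsolKer : Set N.piRat) := N.isClosed_ratKsolKer_of_isClosed_solKer h
  infer_instance

/-- `π₁^{κ-sol}(†𝒟^⊛)` is compact (a continuous image of the profinite `π₁^rat(†𝒟^⊛)`).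
([IUTchI] Ex 5.1 (i) p.124) [claim: Mochizuki2012, status: disputed] -/
theorem compactSpace_piKsol : CompactSpace N.PiKsol := by
  infer_instance

end NFBridgeRecon

end Literature.IUT.HodgeTheaters
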